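import Summits.BirchSwinnertonDyer.Rank1Residual.X11b.RingClassUnitIdele
import Literature.NumberTheory.QuadraticFields.RingClassNumber
import Literature.NumberTheory.QuadraticFields.HeegnerCondition
import HarnessLib

/-!
# CYC, part 1/2: the kernel subgroup of `I_K(m)/P_{K,ℤ}(m) → I_K(m/ℓ)/P_{K,ℤ}(m/ℓ)` at an inert
# `ℓ ∥ m` is cyclic of order dividing `ℓ + 1` (quadratic `K`; `θ`-currency, definition-free)

Team x11b3 (N8/O2), dictionary item CYC (lead GEN 8 R9-5: p8 owns the statements about
`ringClassGalOver`; the ring class GROUP tower `RingClass.restrict` and its kernel of order EXACTLY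
`ℓ + 1` are lit2's `Literature/NumberTheory/QuadraticFields/RingClassGroupTower.lean`, the
group-tower statement of record).  Summit-side THEOREM-ONLY file (no definition, no named fact, no
`sorry`); `K : Type`.  HONEST FRAMING (H47): plumbing toward the Kolyvagin / `h44` programme only —
together with part 2 (`X11b/RingClassTowerCyclic.lean`) and FILE B
(`X11b/KolyvaginRingClassCyclic.lean`) it makes the DATUM `KolyvaginHeegnerData.zpowers_σ`
constructible and discharges the binder `hord` of `KolyvaginH44.h44_of_prop37`; it discharges
neither `h37` nor `h44` nor any class-record hypothesis; nothing is `p = 3`-specific; nothing is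
booked; no mark / label / count moves.

Source statement (Gross 1991, §3, before (3.5); held `book:editornd-l-functions-arithmetic`,
chunk 217 L1): "The subgroups `G_ℓ ≃ F_λˣ/F_ℓˣ` are cyclic of order `ℓ + 1`."  Class field theory
(`Gal(K_n/K) ≃ Pic(𝒪_n)`, Cox §9.A) turns `G_ℓ` into the kernel of `Pic(𝒪_m) → Pic(𝒪_{m/ℓ})`, i.e.
of `I_K(m)/P_{K,ℤ}(m) → I_K(m/ℓ)/P_{K,ℤ}(m/ℓ)` (Cox §7.D (7.27)); this file supplies the weak,
definition-free form of that kernel which part 2 needs.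

## What is proved (no tower MAP is defined; everything in the currency of Cox's `θ`)

For a quadratic field `K` (`[K : ℚ] = 2`), `m = ℓ m'` with `ℓ` prime, `ℓ ∤ m'` and `(ℓ)` prime
in `𝓞_K`:

* `exists_cyclic_subgroup_ringClassGroup` — **there is a CYCLIC subgroup `D ≤ I_K(m)/P_{K,ℤ}(m)`
  of order dividing `ℓ + 1` containing the class `[𝔭_v]_m` of every prime `v ∤ m` whose class of
  conductor `m'` is trivial.**  `D = θ_m(J)` with `J = ker((𝓞_K/m)ˣ → (𝓞_K/m')ˣ)` and Cox's
  `θ_m : (𝓞_K/m)ˣ → I_K(m)/P_{K,ℤ}(m)`, `[α] ↦ [α𝓞_K]` (the tree's `RingClass.theta`): `J` embeds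
  in `(𝓞_K/ℓ)ˣ = F_λˣ` (`#F_λˣ = ℓ² − 1`; a finite subgroup of the units of a domain is cyclic),
  and the image of `J ∩ ker θ_m` in `F_λˣ` contains the image of `(ℤ/ℓ)ˣ` (integers `≡ 1 (mod m')`
  have trivial class, `RingClass.theta_eq_one_iff`), so `#D · #(J ∩ ker θ_m) = #J ∣ (ℓ − 1)(ℓ + 1)`
  with `(ℓ − 1) ∣ #(J ∩ ker θ_m)`; membership: `𝔭_v = (α)`, `α ≡ n (mod m')`
  (`RingClassTower.exists_generator_of_primeClass_eq_one`, p4) and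
  `[𝔭_v]_m = [(dα)]_m = θ_m(dα)` for the CRT integer `d ≡ n⁻¹ (mod m')`, `d ≡ 1 (mod ℓ)`;
* helpers `not_span_le_of_dvd`, `sub_one_mem_span_of_coprime`, `exists_crt_int`,
  `exists_crt_int'`, `idealClass_congr` (elementary; CRT in `ℤ` and in `𝓞_K`).

## References

* B. H. Gross, *Kolyvagin's work on modular elliptic curves*, in *L-functions and Arithmetic*,
  LMS LNS 153 (1991), §3 (held, chunk 217 L1). [GrossLMS1991]
* D. A. Cox, *Primes of the form x² + ny²*, 2nd ed. (2013), §7.D (proof of Thm. 7.24, (7.27))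
  and §9.A. [Cox2013]

## Mathlib / tree search

Tree: `RingClass.theta`, `theta_eq`, `theta_eq_one_iff`, `charP_quot`, `isUnit_mk_intCast`,
`isUnit_mk_of_sup_eq_top`, `mul_sup_eq_top` (`QuadraticFields/RingClassNumber`, `RingClassGroup`);
`RingClassField.primeClass`, `idealClass_span_eq`, `idealClass_mul`, `idealClass_span_eq_one`,
`span_natCast_sup_eq_top`, `sup_span_eq_top_iff_not_le` (`NumberFields/RingClassFieldOfConductor`);
`RingClassTower.exists_generator_of_primeClass_eq_one` (`X11b/RingClassUnitIdele`, p4);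
`Quadratic.exists_basis_zero_eq_one`, `basis_one_mul_self_eq` (`QuadraticFields/HeegnerCondition`).
Mathlib: `Ideal.Quotient.factor`, `Units.map`, `isCyclic_of_injective_ringHom`,
`isCyclic_of_surjective`, `Ideal.absNorm_span_singleton`, `Algebra.norm_algebraMap`,
`NumberField.RingOfIntegers.rank`, `Nat.card_units`, `ZMod.castHom_injective`, `ZMod.card_units`,
`Subgroup.card_dvd_of_injective`, `Subgroup.index_ker`, `Subgroup.card_mul_index`.
-/

noncomputable section

open scoped Classical
open Field NumberField IsDedekindDomain IsDedekindDomain.HeightOneSpectrum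
open Literature.NumberTheory.NumberFields Literature.NumberTheory.NumberFields.RingClassField
open Literature.NumberTheory.QuadraticFields.RingClass
open Literature.NumberTheory.QuadraticFields.Quadratic (exists_basis_zero_eq_one basis_one_mul_self_eq)

namespace Summit.BirchSwinnertonDyer.Rank1Residual.X11b.RingClassTower

variable {K : Type} [Field K] [NumberField K]

/-! ## §1 Elementary lemmas: divisibility of conductors, CRT -/

omit [NumberField K] in
/-- `(f) ⊆ (d)` for `d ∣ f`: a prime not dividing `f` does not divide `d`. [folklore] -/
theorem not_span_le_of_dvd {d f : ℕ} (hdf : d ∣ f) {v : HeightOneSpectrum (𝓞 K)}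
    (hv : ¬ Ideal.span {(f : 𝓞 K)} ≤ v.asIdeal) : ¬ Ideal.span {(d : 𝓞 K)} ≤ v.asIdeal := by
  intro h
  apply hv
  refine le_trans ?_ h
  rw [Ideal.span_singleton_le_span_singleton]
  exact_mod_cast Nat.cast_dvd_cast hdf

omit [NumberField K] in
/-- `a ≡ 1 (mod m'𝓞_K)` and `a ≡ 1 (mod ℓ𝓞_K)` give `a ≡ 1 (mod m𝓞_K)` for `m = ℓ m'`,
`gcd(ℓ, m') = 1` (Chinese remainder theorem: `(m') ∩ (ℓ) = (m)`). [folklore] -/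
theorem sub_one_mem_span_of_coprime {m m' ℓ : ℕ} (hmm' : m = ℓ * m') (hcop : Nat.Coprime ℓ m')
    {a : 𝓞 K} (h₁ : a - 1 ∈ Ideal.span {(m' : 𝓞 K)}) (h₂ : a - 1 ∈ Ideal.span {(ℓ : 𝓞 K)}) :
    a - 1 ∈ Ideal.span {(m : 𝓞 K)} := by
  have hsup : Ideal.span {(ℓ : 𝓞 K)} ⊔ Ideal.span {(m' : 𝓞 K)} = ⊤ :=
    span_natCast_sup_eq_top m' hcop
  have hmul : Ideal.span {(ℓ : 𝓞 K)} * Ideal.span {(m' : 𝓞 K)} = Ideal.span {(m : 𝓞 K)} := by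
    rw [Ideal.span_singleton_mul_span_singleton, hmm', Nat.cast_mul]
  rw [← hmul, Ideal.mul_eq_inf_of_coprime hsup]
  exact ⟨h₂, h₁⟩

/-- The CRT integer of the conductor-descent computation: for `n` prime to `m'` and `ℓ` prime to
`m'` there is `d ∈ ℤ`, prime to `m = ℓ m'` and nonzero, with `d n ≡ 1 (mod m')` and
`d ≡ 1 (mod ℓ)` (as in the proof of `RingClassTower.ringClassChar_eq_one_of_heckeUnramified`).
[folklore] -/
theorem exists_crt_int {m m' ℓ : ℕ} (hmm' : m = ℓ * m') (hcop : Nat.Coprime ℓ m') (hℓ1 : 1 < ℓ)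
    {n : ℤ} (hn : IsCoprime n (m' : ℤ)) :
    ∃ d : ℤ, IsCoprime d (m : ℤ) ∧ d ≠ 0 ∧ (m' : ℤ) ∣ d * n - 1 ∧ (ℓ : ℤ) ∣ d - 1 := by
  obtain ⟨c, e, hce⟩ := hn
  obtain ⟨s, t, hst⟩ := Nat.isCoprime_iff_coprime.mpr hcop
  refine ⟨t * (m' : ℤ) + c * s * (ℓ : ℤ), ?_, ?_, ⟨t * n - s * (ℓ : ℤ) * e - t, ?_⟩,
    ⟨s * (c - 1), ?_⟩⟩
  · have h1 : IsCoprime (t * (m' : ℤ) + c * s * (ℓ : ℤ)) (m' : ℤ) :=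
      ⟨n, -(t * n - s * (ℓ : ℤ) * e - t), by linear_combination (s * (ℓ : ℤ)) * hce + hst⟩
    have h2 : IsCoprime (t * (m' : ℤ) + c * s * (ℓ : ℤ)) (ℓ : ℤ) :=
      ⟨1, -(s * (c - 1)), by linear_combination hst⟩
    rw [hmm', Nat.cast_mul]
    exact IsCoprime.mul_right h2 h1
  · intro h0
    have h2 : IsCoprime (t * (m' : ℤ) + c * s * (ℓ : ℤ)) (ℓ : ℤ) :=
      ⟨1, -(s * (c - 1)), by linear_combination hst⟩
    rw [h0] at h2
    have := isCoprime_zero_left.mp h2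
    rw [Int.isUnit_iff_natAbs_eq, Int.natAbs_natCast] at this
    exact hℓ1.ne' this
  · linear_combination (s * (ℓ : ℤ)) * hce + hst
  · linear_combination hst

/-- Classes of equal ideals are equal (transport of the side conditions). [folklore] -/
theorem idealClass_congr {f : ℕ} {I J : Ideal (𝓞 K)} (h : I = J) (hI : I ≠ ⊥)
    (hIc : I ⊔ Ideal.span {(f : 𝓞 K)} = ⊤) (hJ : J ≠ ⊥) (hJc : J ⊔ Ideal.span {(f : 𝓞 K)} = ⊤) :
    idealClass f hI hIc = idealClass f hJ hJc := by
  subst h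
  rfl

/-- The CRT integer lifting a residue prime to `ℓ` to `≡ 1 (mod m')`: for `c` prime to `ℓ` and
`gcd(ℓ, m') = 1` there is `d ∈ ℤ` prime to `m = ℓ m'` with `d ≡ 1 (mod m')`, `d ≡ c (mod ℓ)`.
[folklore] -/
theorem exists_crt_int' {m m' ℓ : ℕ} (hmm' : m = ℓ * m') (hcop : Nat.Coprime ℓ m')
    {c : ℤ} (hc : IsCoprime c (ℓ : ℤ)) :
    ∃ d : ℤ, IsCoprime d (m : ℤ) ∧ (m' : ℤ) ∣ d - 1 ∧ (ℓ : ℤ) ∣ d - c := by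
  obtain ⟨s, t, hst⟩ := Nat.isCoprime_iff_coprime.mpr hcop
  -- `t m' ≡ 1 (mod ℓ)`; `d := 1 + t m' (c - 1)`
  refine ⟨1 + t * (m' : ℤ) * (c - 1), ?_, ⟨t * (c - 1), by ring⟩, ⟨-(s * (c - 1)), ?_⟩⟩
  · have h1 : IsCoprime (1 + t * (m' : ℤ) * (c - 1)) (m' : ℤ) :=
      ⟨1, -(t * (c - 1)), by ring⟩
    have h2 : IsCoprime (1 + t * (m' : ℤ) * (c - 1)) (ℓ : ℤ) := by
      obtain ⟨u, w, huw⟩ := hc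
      exact ⟨u, w + u * s * (c - 1), by linear_combination huw + u * (c - 1) * hst⟩
    rw [hmm', Nat.cast_mul]
    exact IsCoprime.mul_right h2 h1
  · linear_combination (c - 1) * hst

/-! ## §2 The kernel subgroup at an inert `ℓ ∥ m` -/

/-- **The kernel subgroup at an inert `ℓ ∥ m` is cyclic of order dividing `ℓ + 1`** — the
ring-class-group content of Gross 1991, §3, p. 217: "`G_ℓ ≃ (𝒪_K/ℓ𝒪_K)ˣ/(ℤ/ℓℤ)ˣ ≃ F_λˣ/F_ℓˣ`
is cyclic of order `ℓ + 1`", in the weak form this file needs and WITHOUT the tower map of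
conductors (lit2's `RingClassGroupTower`, R9-5: the group tower of record).  For `K` quadratic,
`m = ℓ m'` with `ℓ` prime, `ℓ ∤ m'`, `(ℓ)` prime in `𝓞_K`: there is a CYCLIC subgroup
`D ≤ I_K(m)/P_{K,ℤ}(m)` with `#D ∣ ℓ + 1` containing `[𝔭_v]_m` for every prime `v ∤ m` with
`[𝔭_v]_{m'} = 1`.  Construction: `D = θ_m(J)`, `J = ker((𝓞_K/m)ˣ → (𝓞_K/m')ˣ)`, with Cox's
`θ_m : (𝓞_K/m)ˣ → I_K(m)/P_{K,ℤ}(m)` (`RingClass.theta`); `J` embeds in `(𝓞_K/ℓ)ˣ = F_λˣ`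
(cyclic, `#F_λˣ = ℓ² − 1`), and `J ∩ ker θ_m` contains the `ℓ − 1` classes of the integers
`≡ 1 (mod m')`; membership of `[𝔭_v]_m`: `𝔭_v = (α)`, `α ≡ n (mod m')`, and
`[𝔭_v]_m = [(dα)]_m = θ_m(dα)` with `d ≡ n⁻¹ (mod m')`, `d ≡ 1 (mod ℓ)` (`exists_crt_int`).
[cite: GrossLMS1991, §3 (p. 217)] [cite: Cox2013, §7.D (7.27)] -/
theorem exists_cyclic_subgroup_ringClassGroup (h2 : Module.finrank ℚ K = 2) {m ℓ : ℕ}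
    (hm : m ≠ 0) (hℓ : ℓ.Prime) (hℓm : ℓ ∣ m) (hℓm' : ¬ ℓ ∣ m / ℓ)
    (hℓP : (Ideal.span {(ℓ : 𝓞 K)}).IsPrime) :
    ∃ D : Subgroup (RingClassGroup K m), IsCyclic D ∧ Nat.card D ∣ ℓ + 1 ∧
      ∀ v : HeightOneSpectrum (𝓞 K), ¬ Ideal.span {(m : 𝓞 K)} ≤ v.asIdeal →
        primeClass (m / ℓ) v = 1 → primeClass m v ∈ D := by
  classical
  -- notation `m = ℓ m'`
  set m' : ℕ := m / ℓ with hm'def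
  have hmm' : m = ℓ * m' := (Nat.mul_div_cancel' hℓm).symm
  have hm'0 : m' ≠ 0 := fun h => hm (by rw [hmm', h, mul_zero])
  have hcopℓ : Nat.Coprime ℓ m' := (Nat.Prime.coprime_iff_not_dvd hℓ).mpr hℓm'
  have hm'm : m' ∣ m := ⟨ℓ, by rw [hmm', mul_comm]⟩
  have hℓle : Ideal.span {(m : 𝓞 K)} ≤ Ideal.span {(ℓ : 𝓞 K)} :=
    Ideal.span_singleton_le_span_singleton.mpr (by exact_mod_cast Nat.cast_dvd_cast hℓm)
  have hm'le : Ideal.span {(m : 𝓞 K)} ≤ Ideal.span {(m' : 𝓞 K)} :=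
    Ideal.span_singleton_le_span_singleton.mpr (by exact_mod_cast Nat.cast_dvd_cast hm'm)
  have hf : Ideal.span {(m : 𝓞 K)} ≠ ⊤ := fun h => hℓP.ne_top (top_le_iff.mp (h ▸ hℓle))
  have hbot : Ideal.span {(m : 𝓞 K)} ≠ ⊥ := by
    rw [Ne, Ideal.span_singleton_eq_bot]; exact_mod_cast hm
  have hℓbot : Ideal.span {(ℓ : 𝓞 K)} ≠ ⊥ := by
    rw [Ne, Ideal.span_singleton_eq_bot]; exact_mod_cast hℓ.ne_zero
  -- integral basis `(1, ω)` and Cox's `θ_m`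
  obtain ⟨b, hb⟩ := exists_basis_zero_eq_one h2
  have hω := basis_one_mul_self_eq b hb
  set θ := theta K m b hb hω hf with hθ
  -- the three quotient rings
  haveI : Finite (𝓞 K ⧸ Ideal.span {(m : 𝓞 K)}) := Ideal.finiteQuotientOfFreeOfNeBot _ hbot
  haveI : (Ideal.span {(ℓ : 𝓞 K)}).IsPrime := hℓP
  set red' : 𝓞 K ⧸ Ideal.span {(m : 𝓞 K)} →+* 𝓞 K ⧸ Ideal.span {(m' : 𝓞 K)} :=
    Ideal.Quotient.factor hm'le with hred'
  set redℓ : 𝓞 K ⧸ Ideal.span {(m : 𝓞 K)} →+* 𝓞 K ⧸ Ideal.span {(ℓ : 𝓞 K)} :=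
    Ideal.Quotient.factor hℓle with hredℓ
  set J : Subgroup (𝓞 K ⧸ Ideal.span {(m : 𝓞 K)})ˣ := (Units.map red'.toMonoidHom).ker with hJ
  set ψ : J →* RingClassGroup K m := θ.comp J.subtype with hψ
  -- membership in `J` and the values of `ψ`, on representatives
  have hJmem : ∀ (x : (𝓞 K ⧸ Ideal.span {(m : 𝓞 K)})ˣ) (a : 𝓞 K),
      Ideal.Quotient.mk _ a = (x : 𝓞 K ⧸ Ideal.span {(m : 𝓞 K)}) →
      (x ∈ J ↔ a - 1 ∈ Ideal.span {(m' : 𝓞 K)}) := by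
    intro x a ha
    rw [hJ, MonoidHom.mem_ker, Units.ext_iff, Units.coe_map, Units.val_one]
    change red' (x : 𝓞 K ⧸ Ideal.span {(m : 𝓞 K)}) = 1 ↔ _
    rw [← ha, hred', Ideal.Quotient.factor_mk, ← (Ideal.Quotient.mk _).map_one, Ideal.Quotient.eq]
  -- (i) `J` embeds in the units of the finite field `𝓞_K/ℓ`, hence is cyclic
  set φ : J →* 𝓞 K ⧸ Ideal.span {(ℓ : 𝓞 K)} :=
    (Units.coeHom _).comp ((Units.map redℓ.toMonoidHom).comp J.subtype) with hφ
  have hφ_apply : ∀ x : J, φ x = redℓ ((x : (𝓞 K ⧸ Ideal.span {(m : 𝓞 K)})ˣ) :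
      𝓞 K ⧸ Ideal.span {(m : 𝓞 K)}) := fun x => rfl
  have hφinj : Function.Injective φ := by
    rw [injective_iff_map_eq_one]
    intro x hx
    obtain ⟨a, ha⟩ := Ideal.Quotient.mk_surjective
      ((x : (𝓞 K ⧸ Ideal.span {(m : 𝓞 K)})ˣ) : 𝓞 K ⧸ Ideal.span {(m : 𝓞 K)})
    have h₁ : a - 1 ∈ Ideal.span {(m' : 𝓞 K)} := (hJmem _ a ha).mp x.2
    have h₂ : a - 1 ∈ Ideal.span {(ℓ : 𝓞 K)} := by
      rw [hφ_apply, ← ha, hredℓ, Ideal.Quotient.factor_mk, ← (Ideal.Quotient.mk _).map_one,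
        Ideal.Quotient.eq] at hx
      exact hx
    have h : a - 1 ∈ Ideal.span {(m : 𝓞 K)} := sub_one_mem_span_of_coprime hmm' hcopℓ h₁ h₂
    apply Subtype.ext
    apply Units.ext
    rw [OneMemClass.coe_one, Units.val_one, ← ha, ← (Ideal.Quotient.mk _).map_one, Ideal.Quotient.eq]
    exact h
  have hJcyc : IsCyclic J := isCyclic_of_injective_ringHom φ hφinj
  refine ⟨ψ.range, isCyclic_of_surjective ψ.rangeRestrict ψ.rangeRestrict_surjective, ?_, ?_⟩
  · -- (ii) `#ψ(J) ∣ ℓ + 1`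
    -- the residue field `F_λ = 𝓞_K/ℓ` has `ℓ²` elements, `F_λˣ` has `ℓ² - 1`
    haveI : (Ideal.span {(ℓ : 𝓞 K)}).IsMaximal := hℓP.isMaximal hℓbot
    haveI : Finite (𝓞 K ⧸ Ideal.span {(ℓ : 𝓞 K)}) := Ideal.finiteQuotientOfFreeOfNeBot _ hℓbot
    have hcardF : Nat.card (𝓞 K ⧸ Ideal.span {(ℓ : 𝓞 K)}) = ℓ ^ 2 := by
      rw [← Submodule.cardQuot_apply, ← Ideal.absNorm_apply, Ideal.absNorm_span_singleton]
      have e : ((ℓ : ℕ) : 𝓞 K) = algebraMap ℤ (𝓞 K) (ℓ : ℤ) := by simp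
      rw [e, Algebra.norm_algebraMap, NumberField.RingOfIntegers.rank, h2]
      simp [Int.natAbs_pow]
    have hcardU : Nat.card (𝓞 K ⧸ Ideal.span {(ℓ : 𝓞 K)})ˣ = ℓ ^ 2 - 1 := by
      letI : Field (𝓞 K ⧸ Ideal.span {(ℓ : 𝓞 K)}) := Ideal.Quotient.field _
      rw [Nat.card_units, hcardF]
    -- `#J ∣ ℓ² - 1`
    set φ' : J →* (𝓞 K ⧸ Ideal.span {(ℓ : 𝓞 K)})ˣ :=
      (Units.map redℓ.toMonoidHom).comp J.subtype with hφ'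
    have hφ'inj : Function.Injective φ' := by
      intro x y hxy
      apply hφinj
      rw [hφ_apply, hφ_apply]
      have h := congrArg (fun u : (𝓞 K ⧸ Ideal.span {(ℓ : 𝓞 K)})ˣ =>
        (u : 𝓞 K ⧸ Ideal.span {(ℓ : 𝓞 K)})) hxy
      simpa [hφ'] using h
    have hJdvd : Nat.card J ∣ ℓ ^ 2 - 1 := hcardU ▸ Subgroup.card_dvd_of_injective φ' hφ'inj
    -- `(ℓ - 1) ∣ # ker ψ`: the image of `(ℤ/ℓ)ˣ` in `F_λˣ` lies in `φ'(ker ψ)`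
    haveI : Fact ℓ.Prime := ⟨hℓ⟩
    haveI : CharP (𝓞 K ⧸ Ideal.span {(ℓ : 𝓞 K)}) ℓ := charP_quot b hb
    set ζ : (ZMod ℓ)ˣ →* (𝓞 K ⧸ Ideal.span {(ℓ : 𝓞 K)})ˣ :=
      Units.map (ZMod.castHom (dvd_refl ℓ) (𝓞 K ⧸ Ideal.span {(ℓ : 𝓞 K)})).toMonoidHom with hζ
    have hζinj : Function.Injective ζ :=
      Units.map_injective (ZMod.castHom_injective (𝓞 K ⧸ Ideal.span {(ℓ : 𝓞 K)}))
    have hZle : ζ.range ≤ (ψ.ker).map φ' := by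
      rintro _ ⟨u, rfl⟩
      -- an integer `d ≡ 1 (mod m')`, `d ≡ u (mod ℓ)`, prime to `m`
      set c : ℤ := ((u : ZMod ℓ).val : ℤ) with hc
      have hcℓ : IsCoprime c (ℓ : ℤ) :=
        Nat.isCoprime_iff_coprime.mpr (ZMod.val_coe_unit_coprime u)
      obtain ⟨d, hdm, ⟨e₁, he₁⟩, ⟨e₂, he₂⟩⟩ := exists_crt_int' hmm' hcopℓ hcℓ
      have hdunit : IsUnit (Ideal.Quotient.mk (Ideal.span {(m : 𝓞 K)}) ((d : ℤ) : 𝓞 K)) :=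
        isUnit_mk_intCast hdm
      set y : (𝓞 K ⧸ Ideal.span {(m : 𝓞 K)})ˣ := hdunit.unit with hy
      have hyd : Ideal.Quotient.mk _ ((d : ℤ) : 𝓞 K) = (y : 𝓞 K ⧸ Ideal.span {(m : 𝓞 K)}) := rfl
      have hyJ : y ∈ J := by
        refine (hJmem y _ hyd).mpr ?_
        have e : ((d : ℤ) : 𝓞 K) - 1 = ((m' : ℕ) : 𝓞 K) * ((e₁ : ℤ) : 𝓞 K) := by
          have := congrArg (fun z : ℤ => (z : 𝓞 K)) he₁
          push_cast at this ⊢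
          exact this
        rw [e]
        exact Ideal.mul_mem_right _ _ (Ideal.mem_span_singleton_self _)
      refine ⟨⟨y, hyJ⟩, ?_, ?_⟩
      · -- `θ_m(d) = 1`: `(d) ∈ P_{K,ℤ}(m)`
        rw [SetLike.mem_coe, MonoidHom.mem_ker, hψ, MonoidHom.comp_apply, Subgroup.coe_subtype,
          hθ, theta_eq_one_iff b hb hω hf]
        refine ⟨1, d, hdm, ?_⟩
        rw [Units.val_one, one_mul, hyd]
      · -- `φ'(d) = ζ(u)`: `d ≡ u (mod ℓ)`
        apply Units.ext
        have e : ((d : ℤ) : 𝓞 K ⧸ Ideal.span {(ℓ : 𝓞 K)}) = ((c : ℤ) : 𝓞 K ⧸ Ideal.span {(ℓ : 𝓞 K)}) := by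
          rw [← sub_eq_zero, ← Int.cast_sub, CharP.intCast_eq_zero_iff _ ℓ]
          exact ⟨e₂, he₂⟩
        simp only [hφ', hζ, MonoidHom.comp_apply, Subgroup.coe_subtype, Units.coe_map,
          RingHom.toMonoidHom_eq_coe, MonoidHom.coe_coe, ZMod.castHom_apply, ZMod.cast_eq_val]
        rw [← hyd, hredℓ, Ideal.Quotient.factor_mk, map_intCast, e, hc, Int.cast_natCast]
    have hℓ1dvd : ℓ - 1 ∣ Nat.card ψ.ker := by
      have h1 : Nat.card ζ.range = ℓ - 1 := by
        rw [← Nat.card_congr (MonoidHom.ofInjective hζinj).toEquiv, Nat.card_eq_fintype_card,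
          ZMod.card_units]
      rw [← h1, ← Subgroup.card_map_of_injective hφ'inj (K := ψ.ker)]
      exact Subgroup.card_dvd_of_le hZle
    -- arithmetic: `#ker ψ · #ψ(J) = #J ∣ (ℓ - 1)(ℓ + 1)` and `(ℓ - 1) ∣ #ker ψ`
    have hJeq : Nat.card ψ.ker * Nat.card ψ.range = Nat.card J := by
      rw [← Subgroup.index_ker ψ, Subgroup.card_mul_index]
    obtain ⟨k, hk⟩ := hℓ1dvd
    have e : ℓ ^ 2 - 1 = (ℓ - 1) * (ℓ + 1) := by
      zify [hℓ.one_lt.le, Nat.one_le_pow 2 ℓ hℓ.pos]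
      ring
    have hdvd : (ℓ - 1) * (k * Nat.card ψ.range) ∣ (ℓ - 1) * (ℓ + 1) := by
      rw [← mul_assoc, ← hk, hJeq, ← e]
      exact hJdvd
    exact (dvd_mul_left _ k).trans
      (Nat.dvd_of_mul_dvd_mul_left (Nat.sub_pos_of_lt hℓ.one_lt) hdvd)
  · -- (iii) `[𝔭_v]_m ∈ ψ(J)` for `v ∤ m` with `[𝔭_v]_{m'} = 1`
    intro v hv h1
    have hv' : ¬ Ideal.span {(m' : 𝓞 K)} ≤ v.asIdeal := not_span_le_of_dvd hm'm hv
    obtain ⟨α, n, hn, hvα, hαn⟩ := exists_generator_of_primeClass_eq_one hv' h1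
    have hα0 : α ≠ 0 := by
      intro h
      apply v.ne_bot
      rw [hvα, h, Ideal.span_singleton_eq_bot]
    obtain ⟨d, hdm, hd0, ⟨e₁, he₁⟩, ⟨e₂, he₂⟩⟩ := exists_crt_int hmm' hcopℓ hℓ.one_lt hn
    -- the element `k₀ = d α ≡ 1 (mod m')`, prime to `m`
    set k₀ : 𝓞 K := ((d : ℤ) : 𝓞 K) * α with hk₀
    have hdK0 : ((d : ℤ) : 𝓞 K) ≠ 0 := by exact_mod_cast hd0
    have hk₀0 : k₀ ≠ 0 := mul_ne_zero hdK0 hα0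
    have hk₀1 : k₀ - 1 ∈ Ideal.span {(m' : 𝓞 K)} := by
      have e1 : k₀ - 1 = ((d : ℤ) : 𝓞 K) * (α - (n : 𝓞 K)) + (((d * n - 1 : ℤ)) : 𝓞 K) := by
        rw [hk₀]; push_cast; ring
      rw [e1]
      refine Ideal.add_mem _ (Ideal.mul_mem_left _ _ hαn) ?_
      rw [he₁]
      push_cast
      exact Ideal.mul_mem_right _ _ (Ideal.mem_span_singleton_self _)
    have hαunit : IsUnit (Ideal.Quotient.mk (Ideal.span {(m : 𝓞 K)}) α) :=
      isUnit_mk_of_sup_eq_top (hvα ▸ (sup_span_eq_top_iff_not_le m).mpr hv)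
    have hdunit : IsUnit (Ideal.Quotient.mk (Ideal.span {(m : 𝓞 K)}) ((d : ℤ) : 𝓞 K)) :=
      isUnit_mk_intCast hdm
    have hk₀unit : IsUnit (Ideal.Quotient.mk (Ideal.span {(m : 𝓞 K)}) k₀) := by
      rw [hk₀, map_mul]; exact hdunit.mul hαunit
    set x : (𝓞 K ⧸ Ideal.span {(m : 𝓞 K)})ˣ := hk₀unit.unit with hx
    have hxk₀ : Ideal.Quotient.mk _ k₀ = (x : 𝓞 K ⧸ Ideal.span {(m : 𝓞 K)}) := rfl
    have hxJ : x ∈ J := (hJmem x k₀ hxk₀).mpr hk₀1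
    refine ⟨⟨x, hxJ⟩, ?_⟩
    -- `ψ x = θ_m(k₀) = [(k₀)]_m = [(d)]_m [(α)]_m = [𝔭_v]_m`
    have hcopα : Ideal.span {α} ⊔ Ideal.span {(m : 𝓞 K)} = ⊤ :=
      hvα ▸ (sup_span_eq_top_iff_not_le m).mpr hv
    have hcopd : Ideal.span {((d : ℤ) : 𝓞 K)} ⊔ Ideal.span {(m : 𝓞 K)} = ⊤ :=
      span_sup_eq_top_of_sub_mem hdm (by rw [sub_self]; exact Submodule.zero_mem _)
    have hcopk₀ : Ideal.span {k₀} ⊔ Ideal.span {(m : 𝓞 K)} = ⊤ := by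
      rw [hk₀, ← Ideal.span_singleton_mul_span_singleton]
      exact mul_sup_eq_top hcopd hcopα
    have hψx : ψ ⟨x, hxJ⟩ = idealClass m (by simpa [Ideal.span_singleton_eq_bot] using hk₀0)
        hcopk₀ := by
      rw [hψ, MonoidHom.comp_apply, Subgroup.coe_subtype, hθ, theta_eq b hb hω hf hxk₀,
        idealClass_span_eq m hk₀0 hcopk₀]
    have hdbot : Ideal.span {((d : ℤ) : 𝓞 K)} ≠ ⊥ := by
      simpa [Ideal.span_singleton_eq_bot] using hdK0
    have hαbot : Ideal.span {α} ≠ ⊥ := by simpa [Ideal.span_singleton_eq_bot] using hα0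
    have hk₀span : Ideal.span {k₀} = Ideal.span {((d : ℤ) : 𝓞 K)} * Ideal.span {α} := by
      rw [Ideal.span_singleton_mul_span_singleton]
    have hcopdα : Ideal.span {((d : ℤ) : 𝓞 K)} * Ideal.span {α} ⊔ Ideal.span {(m : 𝓞 K)} = ⊤ := by
      rw [← hk₀span]; exact hcopk₀
    have hd1 : idealClass m hdbot hcopd = 1 :=
      idealClass_span_eq_one m hdK0 hdm (by rw [sub_self]; exact Submodule.zero_mem _) hcopd
    have hprod : idealClass m (mul_ne_zero hdbot hαbot) hcopdα = idealClass m hαbot hcopα := by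
      rw [idealClass_mul m hdbot hαbot hcopd hcopα hcopdα, hd1]
      exact one_mul (idealClass m hαbot hcopα)
    rw [hψx, primeClass_of_sup_eq_top m ((sup_span_eq_top_iff_not_le m).mpr hv),
      idealClass_congr hk₀span _ hcopk₀ (mul_ne_zero hdbot hαbot) hcopdα, hprod,
      idealClass_congr hvα.symm hαbot hcopα v.ne_bot]

end Summit.BirchSwinnertonDyer.Rank1Residual.X11b.RingClassTower

end
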